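import Summits.ResolutionOfSingularities.ResolutionOfSingularities.Theorems.PurelyInseparableDim4ExceptionalLength
import HarnessLib
import HarnessLib.Audit.Tags

/-!
# Purely inseparable dim 4 — (Λ1): the exceptional length drops at every E-FREE move

Sequel of `PurelyInseparableDim4ExceptionalLength` (p662098).  CARD I-3-12 of cell `res-dim4-pi` (seat idea-3):
let `E = {x_i = 0}` be the newest exceptional divisor of a state `F` of order `≥ p` and `Λ = ℓ_E(F)` the least
`ℓ` with `x_i^ℓ ∈ Ĵ⁺(F)`.  A point blow-up in chart `j` at a point `b` (`b_j = 0`) is **E-free** when the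
direction `e_j + b` is not tangent to `E`, i.e. `j = i` (then it is law (U), `X_pow_pred_mem_of_X_pow_mem`) or
`j ≠ i` and `b_i ≠ 0`.  In the second case `σ_{j,b}^*(x_i^ℓ) = x_j^ℓ · (x_i + b_i)^ℓ` is a power of the NEW
exceptional coordinate times a unit, so (NT) (`X_pow_pred_mem_of_aeval_eq_mul_unit`) gives
`x_j^{ℓ−1} ∈ J_p⁺(F') + 𝔪₀^{M−1}`: **the length of the newest exceptional coordinate drops by one at every
E-free move, in every regime (narrow, wide, `ē ≥ 3`) and every characteristic** — whence the free-run bound of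
CARD I-3-12 (Λ3): at most `Λ − 1 ≤ μ⁺ − 2` consecutive E-free moves along an isolated chain.

[cite: Kollar2007, (3.75.1)–(3.75.3) and Theorem 3.76 (derivative ideals under blow-up; char p, m = p)]
OURS · counted 0 · nothing here proves `NoWideTrap`, `NoIsolatedTrap 3 3`, or resolution of singularities in
dimension `≥ 4` / characteristic `p`.  bears_on: LADDER-RESOLUTION:D157-DOOR2 (res-dim4-pi · I-3-12 (Λ1)).

Typed by seat res-dim4-idea-3 (CARD I-3-12 ADD. 1, `HOME/res-dim4-idea-3/lean/ExcLengthFree.lean`, sha16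
`0b7156dbc1d8fe61`); landed by seat res-dim4-p-5 g2 under DR-157-C verbatim, except this paragraph.
Supports stmt-ResolutionOfSingularities-16155 (helper).
-/

set_option linter.dupNamespace false -- mandated namespace of this single-conjunct summit

namespace Summit.ResolutionOfSingularities.ResolutionOfSingularities.Theorems.PIDim4

namespace ExceptionalLength

open MvPolynomial Finset
open Literature.AlgebraicGeometry
open Literature.AlgebraicGeometry.Resolution

variable {K : Type} [Field K]

/-- The chart substitution on a coordinate OTHER than the chart coordinate: `σ_{j,b}^*(x_i) = x_j (x_i + b_i)`
for `i ≠ j`. [folklore] -/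
theorem aeval_chart_X_ne (j i : Fin 4) (hij : i ≠ j) (b : Fin 4 → K) :
    aeval (fun k => if k = j then (X j : MvPolynomial (Fin 4) K) else X j * (X k + C (b k)))
      (X i : MvPolynomial (Fin 4) K) = X j * (X i + C (b i)) := by
  rw [aeval_X, if_neg hij]

/-- **(Λ1) The exceptional length drops at an E-free move to another chart** (CARD I-3-12): for a state of
order `≥ p`, the previous exceptional coordinate `x_i`, a chart `j ≠ i` and a point `b` with `b_j = 0` and
`b_i ≠ 0` (the direction `e_j + b` is NOT tangent to `E = {x_i = 0}`):
`x_i^ℓ ∈ J_p⁺(F) + 𝔪₀^M ⇒ x_j^{ℓ−1} ∈ J_p⁺(F') + 𝔪₀^{M−1}`, `F'` the cleaned transform, `x_j` the NEW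
exceptional coordinate.  (The same-chart case `j = i` is `X_pow_pred_mem_of_X_pow_mem`.)
[cite: Kollar2007, Theorem 3.76 (char p, m = p)] -/
theorem X_pow_pred_mem_of_X_pow_mem_of_ne (p : ℕ) [Fact p.Prime] [CharP K p] [DecidableEq K]
    (s : State K) (j i : Fin 4) (hij : i ≠ j) (b : Fin 4 → K) (hbj : b j = 0) (hbi : b i ≠ 0)
    (hord : (p : ℕ∞) ≤ CentreBlowup.ordAlong Finset.univ s.F) {ℓ M : ℕ} (hℓ : 1 ≤ ℓ)
    (hx : (X i : MvPolynomial (Fin 4) K) ^ ℓ ∈ singLocusIdeal p s.F ⊔ originIdeal K ^ M) :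
    (X j : MvPolynomial (Fin 4) K) ^ (ℓ - 1) ∈
      singLocusIdeal p (CentreBlowup.step p Finset.univ j b s).F ⊔ originIdeal K ^ (M - 1) := by
  have hσ : aeval (fun k => if k = j then (X j : MvPolynomial (Fin 4) K) else X j * (X k + C (b k)))
      ((X i : MvPolynomial (Fin 4) K) ^ ℓ) = X j ^ ℓ * (X i + C (b i)) ^ ℓ := by
    rw [map_pow, aeval_chart_X_ne j i hij b, mul_pow]
  have hh : constantCoeff ((X i + C (b i) : MvPolynomial (Fin 4) K) ^ ℓ) ≠ 0 := by
    rw [map_pow, map_add, constantCoeff_X, constantCoeff_C, zero_add]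
    exact pow_ne_zero ℓ hbi
  exact X_pow_pred_mem_of_aeval_eq_mul_unit p s j b hbj hord hℓ hx hσ hh

/-- **(Λ1), all levels at once**: `(∀ M, x_i^ℓ ∈ J_p⁺(F) + 𝔪₀^M) ⇒ ∀ M, x_j^{ℓ−1} ∈ J_p⁺(F') + 𝔪₀^M` for an
E-free move to chart `j ≠ i` (`b_j = 0`, `b_i ≠ 0`).  [cite: Kollar2007, Theorem 3.76 (char p, m = p)] -/
theorem forall_X_pow_pred_mem_of_forall_X_pow_mem_of_ne (p : ℕ) [Fact p.Prime] [CharP K p] [DecidableEq K]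
    (s : State K) (j i : Fin 4) (hij : i ≠ j) (b : Fin 4 → K) (hbj : b j = 0) (hbi : b i ≠ 0)
    (hord : (p : ℕ∞) ≤ CentreBlowup.ordAlong Finset.univ s.F) {ℓ : ℕ} (hℓ : 1 ≤ ℓ)
    (hx : ∀ M : ℕ, (X i : MvPolynomial (Fin 4) K) ^ ℓ ∈ singLocusIdeal p s.F ⊔ originIdeal K ^ M)
    (M : ℕ) :
    (X j : MvPolynomial (Fin 4) K) ^ (ℓ - 1) ∈
      singLocusIdeal p (CentreBlowup.step p Finset.univ j b s).F ⊔ originIdeal K ^ M := by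
  have h := X_pow_pred_mem_of_X_pow_mem_of_ne p s j i hij b hbj hbi hord hℓ (hx (M + 1))
  rwa [Nat.add_sub_cancel] at h

/-- **(Λ1), both cases in one statement**: for a move in chart `j` at `b` (`b_j = 0`) that is E-free with
respect to `E = {x_i = 0}` — `j = i`, or `b_i ≠ 0` — the length of the new exceptional coordinate is at most
the old length minus one: `(∀ M, x_i^ℓ ∈ J_p⁺(F) + 𝔪₀^M) ⇒ ∀ M, x_j^{ℓ−1} ∈ J_p⁺(F') + 𝔪₀^M`.
[cite: Kollar2007, Theorem 3.76 (char p, m = p)] -/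
theorem forall_X_pow_pred_mem_of_free (p : ℕ) [Fact p.Prime] [CharP K p] [DecidableEq K]
    (s : State K) (j i : Fin 4) (b : Fin 4 → K) (hbj : b j = 0) (hfree : j = i ∨ b i ≠ 0)
    (hord : (p : ℕ∞) ≤ CentreBlowup.ordAlong Finset.univ s.F) {ℓ : ℕ} (hℓ : 1 ≤ ℓ)
    (hx : ∀ M : ℕ, (X i : MvPolynomial (Fin 4) K) ^ ℓ ∈ singLocusIdeal p s.F ⊔ originIdeal K ^ M)
    (M : ℕ) :
    (X j : MvPolynomial (Fin 4) K) ^ (ℓ - 1) ∈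
      singLocusIdeal p (CentreBlowup.step p Finset.univ j b s).F ⊔ originIdeal K ^ M := by
  by_cases hij : i = j
  · subst hij
    exact forall_X_pow_pred_mem_of_forall_X_pow_mem p s i b hbj hord hℓ hx M
  · have hbi : b i ≠ 0 := by
      rcases hfree with h | h
      · exact absurd h.symm hij
      · exact h
    exact forall_X_pow_pred_mem_of_forall_X_pow_mem_of_ne p s j i hij b hbj hbi hord hℓ hx M

end ExceptionalLength

end Summit.ResolutionOfSingularities.ResolutionOfSingularities.Theorems.PIDim4
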